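/-
Origin: expansion seat `planner-pub-hodgecm-pv09-g6-0`, handover #5 2026-08-18T12:12:32Z (`HOME/pub-hodgecm-pv09-g6/lean/Pv09g6/GenuineTensorContinuity.lean`, md5 773aeb55, 233 lines);
landed by the gen-8 packager in gate run 29 as `HodgeCM/PerL34/GenuineTensorContinuity.lean` (import ^import Pv09g6\.GenuineTensorModel[ \t]*$→import HodgeCM.PerL34.GenuineTensorModel ×1).
-/
/-
# Strong continuity of the restricted tensor product representation `⊗′ρ_i` (pv09-g6 #5, RUN 29/30)

WIP imports: `Pv09g6.GenuineTensorModel` ↦ `HodgeCM.PerL34.GenuineTensorModel` (pv09-g6 #2, queued RUN 29).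

`#1 RestrictedTensor` proved the PER-PLACE strong continuity `g ↦ (⊗′ρ)(ι_i g) v` (the END's `hloc`).
Here: the FULL representation `⊗′ρ : Πʳ_i [G_i, B_i] →* U(⊗′_i (H_i, e_i))` is STRONGLY CONTINUOUS for the
restricted-product topology (all `B_i` open subgroups, every `ρ_i` strongly continuous) — i.e. `(⊗′ρ, ⊗′H)` is a
bona fide continuous unitary representation of the restricted product; specialised to the genuine torus model of a
CM field (`#2`): `k ↦ ω(k) v` is continuous on `U(1)_{L/L⁺}(𝔸_{L⁺,f}) = Model L` for every `v ∈ ⊗′_v L²((L⁺_v)³)`.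

Proof: for a pure tensor `⊗x` the diagonal coefficient `k ↦ ⟪⊗x, (⊗′ρ)(k) ⊗x⟫ = ∏ᶠ_i ⟪x_i, ρ_i(k_i) x_i⟫` is, on the
open box `∏_i B_i ↪ Πʳ` (Mathlib `RestrictedProduct.nhds_eq_map_structureMap`), a FINITE product of continuous
functions (outside the finite set where `x_i ≠ e_i` or `B_i` might move `e_i`, the factor is `⟪e_i, e_i⟫ = 1`), hence
continuous at `1`; for isometries `‖π(k)v - v‖² = 2‖v‖² - 2 re ⟪v, π(k)v⟫`, so the orbit map of `⊗x` is continuous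
at `1`; vectors with orbit map continuous at `1` form a submodule closed under uniform approximation (isometries),
and pure tensors are total; finally continuity at `1` ⇒ continuity everywhere (`#2 continuous_apply_of_continuousAt_one`).
Kernel-checked: no new axiom, nothing cited, nothing posited.
-/
import Summits.HodgeConjecture.HodgeCM.PerL34.GenuineTensorModel_2

set_option autoImplicit false

noncomputable section

open Function Set Filter Topology HodgeCM.PerL34.NoSmallSubgroups
open scoped InnerProductSpace ComplexConjugate RestrictedProduct

namespace HodgeCM.PerL34.RestrictedTensor

/-! ## §A  Unitary representations on Hilbert spaces: two general continuity lemmas -/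

section UnitaryHilbert

variable {K : Type*} [TopologicalSpace K] [Group K]
  {E : Type*} [NormedAddCommGroup E] [InnerProductSpace ℂ E]

/-- For a representation by isometries, the orbit map of `v` is continuous at `1` as soon as the diagonal
matrix coefficient `k ↦ ⟪v, π(k) v⟫` is (`‖π(k)v - v‖² = 2‖v‖² - 2 re ⟪v, π(k)v⟫`). -/
theorem continuousAt_one_apply_of_inner (π : K →* (E ≃ₗᵢ[ℂ] E)) (v : E)
    (h : ContinuousAt (fun k => ⟪v, π k v⟫_ℂ) 1) : ContinuousAt (fun k => π k v) 1 := by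
  have h1 : π 1 v = v := by rw [map_one]; rfl
  have hsq : ∀ k, ‖π k v - v‖ ^ 2 = 2 * ‖v‖ ^ 2 - 2 * RCLike.re ⟪v, π k v⟫_ℂ := fun k => by
    rw [@norm_sub_sq ℂ, LinearIsometryEquiv.norm_map, ← inner_conj_symm, RCLike.conj_re]; ring
  have h2 : Tendsto (fun k => RCLike.re ⟪v, π k v⟫_ℂ) (𝓝 1) (𝓝 (‖v‖ ^ 2)) := by
    have := RCLike.continuous_re.continuousAt.tendsto.comp h
    simp only [Function.comp_def, h1, inner_self_eq_norm_sq] at this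
    exact this
  have h3 := (tendsto_const_nhds (x := 2 * ‖v‖ ^ 2) (f := 𝓝 (1 : K))).sub (h2.const_mul 2)
  rw [sub_self] at h3
  have h4 := h3.sqrt
  rw [Real.sqrt_zero] at h4
  change Tendsto (fun k => π k v) (𝓝 1) (𝓝 (π 1 v))
  rw [h1, tendsto_iff_norm_sub_tendsto_zero]
  refine h4.congr fun k => ?_
  rw [← hsq, Real.sqrt_sq (norm_nonneg _)]

/-- For a representation by isometries of a group with continuous multiplication: if the orbit maps of a TOTAL
set of vectors are continuous at `1`, every orbit map is continuous. -/
theorem continuous_apply_of_dense [ContinuousMul K] (π : K →* (E ≃ₗᵢ[ℂ] E)) {D : Set E}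
    (hD : Dense ((Submodule.span ℂ D : Submodule ℂ E) : Set E))
    (h : ∀ v ∈ D, ContinuousAt (fun k => π k v) 1) (v : E) : Continuous fun k => π k v := by
  let M : Submodule ℂ E :=
    { carrier := {v | ContinuousAt (fun k => π k v) 1}
      add_mem' := fun {a b} ha hb => by
        simp only [Set.mem_setOf_eq, map_add] at ha hb ⊢
        exact ha.add hb
      zero_mem' := by simp only [Set.mem_setOf_eq, map_zero]; exact continuousAt_const
      smul_mem' := fun c a ha => by
        simp only [Set.mem_setOf_eq, map_smul] at ha ⊢
        exact ha.const_smul c }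
  have hM : Submodule.span ℂ D ≤ M := Submodule.span_le.mpr fun w hw => h w hw
  have hdense : Dense (M : Set E) := hD.mono hM
  refine continuous_apply_of_continuousAt_one π v ?_
  refine continuousAt_of_locally_uniform_approx_of_continuousAt fun u hu => ?_
  obtain ⟨ε, hε, hεu⟩ := Metric.mem_uniformity_dist.mp hu
  obtain ⟨w, hwM, hw⟩ := hdense.exists_dist_lt v hε
  refine ⟨univ, univ_mem, fun k => π k w, hwM, fun k _ => hεu ?_⟩
  rw [dist_eq_norm, ← map_sub, LinearIsometryEquiv.norm_map, ← dist_eq_norm]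
  exact hw

/-- For a representation by isometries, strong continuity is JOINT continuity of `(k, v) ↦ π(k) v`
(`‖π(k)v - π(k₀)v₀‖ ≤ ‖v - v₀‖ + ‖π(k)v₀ - π(k₀)v₀‖`). -/
theorem continuous_uncurry_of_isometry (π : K →* (E ≃ₗᵢ[ℂ] E)) (h : ∀ v, Continuous fun k => π k v) :
    Continuous fun p : K × E => π p.1 p.2 := by
  refine continuous_iff_continuousAt.2 ?_
  rintro ⟨k₀, v₀⟩
  rw [ContinuousAt, tendsto_iff_norm_sub_tendsto_zero]
  show Tendsto (fun p : K × E => ‖π p.1 p.2 - π k₀ v₀‖) (𝓝 (k₀, v₀)) (𝓝 0)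
  have ha' : Continuous fun p : K × E => p.2 - v₀ := continuous_snd.sub continuous_const
  have hb' : Continuous fun p : K × E => π p.1 v₀ - π k₀ v₀ := ((h v₀).comp continuous_fst).sub continuous_const
  have ha : Tendsto (fun p : K × E => ‖p.2 - v₀‖) (𝓝 (k₀, v₀)) (𝓝 0) := by
    simpa using ha'.norm.tendsto (k₀, v₀)
  have hb : Tendsto (fun p : K × E => ‖π p.1 v₀ - π k₀ v₀‖) (𝓝 (k₀, v₀)) (𝓝 0) := by
    simpa using hb'.norm.tendsto (k₀, v₀)
  refine squeeze_zero (fun _ => norm_nonneg _) (fun p => ?_) (by simpa using ha.add hb)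
  calc ‖π p.1 p.2 - π k₀ v₀‖ = ‖π p.1 (p.2 - v₀) + (π p.1 v₀ - π k₀ v₀)‖ := by
        rw [map_sub]; congr 1; abel
    _ ≤ ‖π p.1 (p.2 - v₀)‖ + ‖π p.1 v₀ - π k₀ v₀‖ := norm_add_le _ _
    _ = ‖p.2 - v₀‖ + ‖π p.1 v₀ - π k₀ v₀‖ := by rw [LinearIsometryEquiv.norm_map]

end UnitaryHilbert

/-! ## §B  `⊗′ρ` is strongly continuous on the restricted product -/

section Continuity

universe u v

variable {ι : Type u} {H : ι → Type v} [∀ i, NormedAddCommGroup (H i)] [∀ i, InnerProductSpace ℂ (H i)]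
  {𝓔 : UnitFamily H}
  {G : ι → Type*} [∀ i, Group (G i)] {Sub : ι → Type*} [∀ i, SetLike (Sub i) (G i)]
  [∀ i, SubgroupClass (Sub i) (G i)] {B : ∀ i, Sub i} {ρ : ∀ i, G i →* (H i ≃ₗᵢ[ℂ] H i)}
  (hρ : Admissible 𝓔 B ρ) [∀ i, TopologicalSpace (G i)]

/-- The diagonal coefficient `k ↦ ⟪⊗x, (⊗′ρ)(k) ⊗x⟫` of a pure tensor is continuous at `1` (all `B_i` open, all
`ρ_i` strongly continuous): on the open box `∏ B_i` it is a finite product of local coefficients. -/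
theorem continuousAt_one_inner_rep_tp (hBopen : ∀ i, IsOpen (B i : Set (G i)))
    (hcont : ∀ i (w : H i), Continuous fun g : G i => ρ i g w) (x : RVec 𝓔) :
    ContinuousAt (fun k : Πʳ i, [G i, B i] => ⟪tp 𝓔 x, rep hρ k (tp 𝓔 x)⟫_ℂ) 1 := by
  classical
  -- the finite set of indices where `x_i ≠ e_i` or `B_i` might move `e_i`
  have hE : Set.Finite {i | ¬ ∀ b ∈ B i, ρ i b (𝓔.e i) = 𝓔.e i} := by
    have h := hρ
    rwa [Admissible, Filter.eventually_cofinite] at h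
  let T : Finset ι := (x.finite_ne.union hE).toFinset
  -- the open box `∏ B_i` and its identity point
  let A : ∀ i, Set (G i) := fun i => (B i : Set (G i))
  let e : ∀ i, A i := fun i => ⟨1, one_mem (B i)⟩
  have he : RestrictedProduct.structureMap G A cofinite e = (1 : Πʳ i, [G i, B i]) := by
    ext i
    rfl
  -- on the box the coefficient is a finite product of continuous functions
  let cb : (∀ i, A i) → ℂ := fun b => ∏ i ∈ T, ⟪x i, ρ i (b i : G i) (x i)⟫_ℂ
  have hcb : Continuous cb :=
    continuous_finsetProd T fun i _ =>
      continuous_const.inner ((hcont i (x i)).comp (continuous_subtype_val.comp (continuous_apply i)))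
  have hcomp : (fun k : Πʳ i, [G i, B i] => ⟪tp 𝓔 x, rep hρ k (tp 𝓔 x)⟫_ℂ) ∘
      RestrictedProduct.structureMap G A cofinite = cb := by
    funext b
    rw [Function.comp_apply, inner_tp_rep_tp]
    change (∏ᶠ i, ⟪x i, ρ i (b i : G i) (x i)⟫_ℂ) = ∏ i ∈ T, ⟪x i, ρ i (b i : G i) (x i)⟫_ℂ
    refine finprod_eq_prod_of_mulSupport_subset _ fun i hi => ?_
    rw [Function.mem_mulSupport] at hi
    rw [Set.Finite.coe_toFinset]
    by_contra hnot
    rw [Set.mem_union, not_or, Set.mem_setOf_eq, Set.mem_setOf_eq, not_not, not_not] at hnot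
    exact hi (by rw [hnot.1, hnot.2 _ (b i).2, inner_e_e])
  have h1 : ⟪tp 𝓔 x, rep hρ (RestrictedProduct.structureMap G A cofinite e) (tp 𝓔 x)⟫_ℂ = cb e :=
    congr_fun hcomp e
  -- transfer through the open embedding of the box
  rw [ContinuousAt, ← he, RestrictedProduct.nhds_eq_map_structureMap hBopen e, Filter.tendsto_map'_iff, hcomp,
    h1]
  exact hcb.continuousAt

/-- **Strong continuity of `⊗′ρ`.**  If every `B_i` is an open subgroup and every `ρ_i` is strongly continuous,
then `k ↦ (⊗′ρ)(k) v` is continuous on `Πʳ_i [G_i, B_i]` for every `v ∈ ⊗′_i (H_i, e_i)`. -/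
theorem continuous_rep [∀ i, ContinuousMul (G i)] (hBopen : ∀ i, IsOpen (B i : Set (G i)))
    (hcont : ∀ i (w : H i), Continuous fun g : G i => ρ i g w) (v : Space 𝓔) :
    Continuous fun k : Πʳ i, [G i, B i] => rep hρ k v := by
  haveI : Fact (∀ i, IsOpen (B i : Set (G i))) := ⟨hBopen⟩
  refine continuous_apply_of_dense (rep hρ) dense_span_tp (fun w hw => ?_) v
  obtain ⟨x, rfl⟩ := hw
  exact continuousAt_one_apply_of_inner (rep hρ) (tp 𝓔 x) (continuousAt_one_inner_rep_tp hρ hBopen hcont x)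

/-- hence every matrix coefficient `k ↦ ⟪u, (⊗′ρ)(k) v⟫` is continuous. -/
theorem continuous_inner_rep [∀ i, ContinuousMul (G i)] (hBopen : ∀ i, IsOpen (B i : Set (G i)))
    (hcont : ∀ i (w : H i), Continuous fun g : G i => ρ i g w) (u v : Space 𝓔) :
    Continuous fun k : Πʳ i, [G i, B i] => ⟪u, rep hρ k v⟫_ℂ :=
  continuous_const.inner (continuous_rep hρ hBopen hcont v)

/-- joint continuity `(k, v) ↦ (⊗′ρ)(k) v`. -/
theorem continuous_rep_uncurry [∀ i, ContinuousMul (G i)] (hBopen : ∀ i, IsOpen (B i : Set (G i)))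
    (hcont : ∀ i (w : H i), Continuous fun g : G i => ρ i g w) :
    Continuous fun p : (Πʳ i, [G i, B i]) × Space 𝓔 => rep hρ p.1 p.2 :=
  continuous_uncurry_of_isometry (rep hρ) (continuous_rep hρ hBopen hcont)

end Continuity

/-! ## §C  The genuine torus model of a CM field: `ω = ⊗′ρ_v` is a continuous unitary representation of
`U(1)_{L/L⁺}(𝔸_{L⁺,f})` -/

namespace Genuine

open NumberField IsDedekindDomain HodgeCM.PerL34.IdelePlaces
open HodgeCM.PerL34.IdelicTorusModel HodgeCM.PerL34.IdelicTorusModel.Genuine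

variable (L : Type) [Field L] [NumberField L] [IsCMField L] [DecidableEq (Place (maximalRealSubfield L))]
  [∀ v : HeightOneSpectrum (𝓞 (maximalRealSubfield L)), MeasurableSpace (v.adicCompletion (maximalRealSubfield L))]
  [∀ v : HeightOneSpectrum (𝓞 (maximalRealSubfield L)), BorelSpace (v.adicCompletion (maximalRealSubfield L))]
  {χ : Model L →* Circle}
  {ν : ∀ i : Place (maximalRealSubfield L),
    ((basePlaceOf L i).adicCompletion (maximalRealSubfield L))ˣ →* Circle}
  {S T' : Finset (Place (maximalRealSubfield L))}
  (hν : ∀ i, i ∉ S → IsSplitPlace L i → ∀ u : ((basePlaceOf L i).adicCompletion (maximalRealSubfield L))ˣ,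
    ‖(u : (basePlaceOf L i).adicCompletion (maximalRealSubfield L))‖ = 1 → ν i u = 1)
  (hχT' : RestrictedProduct.boxSubgroup (genLevel L) T' ≤ χ.ker)

/-- **`ω := ⊗′_v ρ_v` is STRONGLY CONTINUOUS on `U(1)_{L/L⁺}(𝔸_{L⁺,f})`** (restricted-product topology), for the
natural local data: `ν_i` continuous at the split places, `χ` of level `K_{T'}` and locally continuous on `T'`. -/
theorem continuous_rep_apply (hνc : ∀ i, IsSplitPlace L i → Continuous (ν i))
    (hlocχ : ∀ i ∈ T', Continuous fun g : locTorus (maximalRealSubfield L) L i =>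
      χ (RestrictedProduct.mulSingle (genLevel L) i g))
    (v : Space (unitFam L)) :
    Continuous fun k : Model L => rep (admissible L hν hχT') k v :=
  continuous_rep (admissible L hν hχT') (fun i => isOpen_genLevel L i) (continuous_locRep_apply L hχT' hνc hlocχ) v

/-- and all matrix coefficients `k ↦ ⟪u, ω(k) v⟫` (in particular `k ↦ ⟪φ, ω(k) φ⟫`) are continuous on
`U(1)(𝔸_{L⁺,f})`. -/
theorem continuous_inner_rep_apply (hνc : ∀ i, IsSplitPlace L i → Continuous (ν i))
    (hlocχ : ∀ i ∈ T', Continuous fun g : locTorus (maximalRealSubfield L) L i =>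
      χ (RestrictedProduct.mulSingle (genLevel L) i g))
    (u v : Space (unitFam L)) :
    Continuous fun k : Model L => ⟪u, rep (admissible L hν hχT') k v⟫_ℂ :=
  continuous_const.inner (continuous_rep_apply L hν hχT' hνc hlocχ v)

/-- joint continuity `(k, v) ↦ ω(k) v` on `U(1)(𝔸_{L⁺,f}) × ⊗′H`. -/
theorem continuous_rep_uncurry (hνc : ∀ i, IsSplitPlace L i → Continuous (ν i))
    (hlocχ : ∀ i ∈ T', Continuous fun g : locTorus (maximalRealSubfield L) L i =>
      χ (RestrictedProduct.mulSingle (genLevel L) i g)) :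
    Continuous fun p : Model L × Space (unitFam L) => rep (admissible L hν hχT') p.1 p.2 :=
  continuous_uncurry_of_isometry _ (continuous_rep_apply L hν hχT' hνc hlocχ)

/-- UNCONDITIONAL instance: the smoke model (`ν = 1`, `χ = 1`) is a continuous unitary representation of
`U(1)(𝔸_{L⁺,f})` for every CM field `L`. -/
theorem continuous_omegaOne_apply (S : Finset (Place (maximalRealSubfield L))) (v : Space (unitFam L)) :
    Continuous fun k : Model L => omegaOne L S k v :=
  continuous_rep_apply L (one_unram L S) (boxSubgroup_le_ker_one L) (fun _ _ => continuous_const)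
    (fun _ _ => continuous_const) v

end Genuine

end HodgeCM.PerL34.RestrictedTensor
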